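import Literature.NumberTheory.GaloisRepresentations.LubinTateTowerGenerator
import HarnessLib

/-!
# Generators of the Tate module of `F_f` are unique up to ONE unit: `(ω'_n) = ([a] ω_n)`, `a ∈ 𝒪_Fˣ`
# (de Shalit I §2.2, II §4.4 (i)–(iv); Cassels–Fröhlich VI §3.6 Prop. 6 — proofs only)

Topic `NumberTheory/GaloisRepresentations` (theorems only; no definition, no named fact, no instance).  Sequel of
`LubinTateTowerGenerator.lean`: there, for `f = πX + X^q` over a non-archimedean local field `F`, a COHERENT generator
`ω_{n+1} = cohPt hπ n ∈ 𝔪_{K_π^{n+1}}` of the Tate module of `F_f` is fixed (`[π] ω_{n+2} = ω_{n+1}`, `ω_{n+1}` primitive of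
level `n+1`).  de Shalit (I §2.2, II §4.4) works with an ARBITRARY generator `(ω_i)`, `ω_i ∈ W_f^i ∖ W_f^{i−1}`,
`f(ω_i) = ω_{i−1}`; II §4.4 lists the equivalent data (i) `Ω_p`, (ii) `θ`, (iii) `(ω_n)`, (iv) `(u_n)`, each determined «modulo
`𝒪_𝔭ˣ`».  This file proves the uniqueness statement behind that remark, at the level of elements of `F̄` (so that a consumer
may produce its generator in any finite extensions it likes):

* `aeval_ltPolyDiv_eq_zero_of_primitive` — an `x ∈ F̄` with `f^{(n+1)}(x) = 0`, `f^{(n)}(x) ≠ 0` is a root of `φ_{n+1}`;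
* `ltAct_cohPt_eq_iff` — `[a] ω_{n+1} = [b] ω_{n+1} ↔ a ≡ b (mod π^{n+1})`; `coe_ltAct_pi_cohPt_succ`;
* ★ `exists_unit_coe_ltAct_cohPt_eq` — every root of `φ_{n+1}` in `F̄` is `[u] ω_{n+1}`, `u ∈ 𝒪_Fˣ` (levelwise);
* ★★★ `exists_unit_forall_coe_ltAct_cohPt_eq` — **for `μ : ℕ → F̄` with `φ_{n+1}(μ_n) = 0` and `f(μ_{n+1}) = μ_n` for all `n`
  there is `a ∈ 𝒪_Fˣ` with `[a] ω_{n+1} = μ_n` for ALL `n`** (the levelwise units are compatible modulo `π^{n+1}` by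
  coherence; pass to the limit in the `π`-adically complete `𝒪_F`, tree `exists_unit_forall_pow_dvd_sub`);
  `existsUnique_unit_forall_coe_ltAct_cohPt_eq` — and `a` is unique (`eq_of_forall_pow_dvd_sub`).

Use (cell `bsd-print-cf2`, CM bridge, memo `B6-BRIDGE-II-VALUES-w4g13.md` §3): de Shalit's generator `ω_n = t(ξ(Λ(𝔭⁻ⁿ)u_n))`
(II.4.4 (12)) read through `[1]_{f,[π]_E}` and the tree's `cohPt` differ by ONE `a ∈ 𝒪_𝔭ˣ = ℤ_pˣ` — the `κ(I_v)`-ambiguity of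
the `p`-adic period `Ω_p` (II.4.3 «`Ω_p` is uniquely determined modulo `𝒪_𝔭ˣ`»).  Seat `bsd-line-cf2c-w4` g14; no summit statement
is proved; BSD is not proved by any of this.

## References
* [deShalit1987] E. de Shalit, *Iwasawa theory of elliptic curves with complex multiplication* (1987), I §2.2 («a generator of
  the Tate module of `F_f`»), II §4.3–4.4 (i)–(iv).
* [CasselsFrohlichANT1967] J.-P. Serre, *Local class field theory* (Cassels–Fröhlich Ch. VI), §3.6 Prop. 6.
* [LubinTate1965] J. Lubin, J. Tate, Ann. of Math. 81 (1965), Thm. 2.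
-/

noncomputable section

open Filter Topology Polynomial

namespace Literature.NumberTheory.GaloisRepresentations

section Concrete

open ValuativeRel GaloisRepresentations.IsNonarchimedeanLocalField LubinTate

variable {F : Type*} [Field F] [ValuativeRel F] [TopologicalSpace F] [IsNonarchimedeanLocalField F]

attribute [local instance] instUniformSpace_literature rk1 nF nE ltCharIsUniformAddGroup

variable {π : 𝒪[F]} (hπ : (valuation F).IsUniformizer (π : F))

/-! ### Primitive division points in `F̄` are roots of `φ_{n+1}` -/

/-- **A primitive `π^{n+1}`-division point is a root of `φ_{n+1}`**: in any `F`-field without zero divisors, `f^{(n+1)}(x) = 0`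
and `f^{(n)}(x) ≠ 0` force `φ_{n+1}(x) = 0` (`f^{(n+1)} = f^{(n)} · φ_{n+1}`). [cite: CasselsFrohlichANT1967, Ch. VI §3.6 Prop. 6 (proof)] -/
theorem aeval_ltPolyDiv_eq_zero_of_primitive {B : Type*} [Field B] [Algebra F B] {n : ℕ} {x : B}
    (h1 : aeval x ((ltPolyIter F π (n + 1)).map (algebraMap 𝒪[F] F)) = 0)
    (h0 : aeval x ((ltPolyIter F π n).map (algebraMap 𝒪[F] F)) ≠ 0) :
    aeval x ((ltPolyDiv F π n).map (algebraMap 𝒪[F] F)) = 0 := by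
  rw [ltPolyIter_succ_eq_mul, Polynomial.map_mul, aeval_mul] at h1
  exact (mul_eq_zero.mp h1).resolve_left h0

/-! ### `[a] ω_{n+1}` -/

/-- **`[a] ω_{n+1} = [b] ω_{n+1} ↔ a ≡ b (mod π^{n+1})`** (`ω_{n+1} = [u_n] λ_{n+1}` with `u_n` a unit; tree
`ltAct_genPt_eq_iff`). [cite: CasselsFrohlichANT1967, Ch. VI §3.6 Prop. 6 (a)] -/
theorem ltAct_cohPt_eq_iff {n : ℕ} {a b : 𝒪[F]} :
    ltAct hπ n a (cohPt hπ n) = ltAct hπ n b (cohPt hπ n) ↔ π ^ (n + 1) ∣ a - b := by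
  rw [cohPt_eq, ← ltAct_mul, ← ltAct_mul, ltAct_genPt_eq_iff, ← sub_mul]
  refine ⟨fun h => ?_, fun h => h.mul_right _⟩
  have hu : IsUnit ((cohUnit hπ n : 𝒪[F]ˣ) : 𝒪[F]) := Units.isUnit _
  exact (hu.dvd_mul_right).mp h

/-- `[a] ω_{n+1} = [b] ω_{n+1}` when `π^{n+1} ∣ a − b`. [cite: CasselsFrohlichANT1967, Ch. VI §3.6 Prop. 6 (a)] -/
theorem ltAct_cohPt_eq_of_dvd_sub {n : ℕ} {a b : 𝒪[F]} (h : π ^ (n + 1) ∣ a - b) :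
    ltAct hπ n a (cohPt hπ n) = ltAct hπ n b (cohPt hπ n) :=
  (ltAct_cohPt_eq_iff hπ).mpr h

/-- `[π]([a] ω_{n+2}) = ι([a] ω_{n+1})` (coherence of `(ω_n)` and `[π][a] = [a][π]`). [cite: deShalit1987, Ch. I §2.2] -/
theorem ltAct_pi_ltAct_cohPt_succ (n : ℕ) (a : 𝒪[F]) :
    ltAct hπ (n + 1) π (ltAct hπ (n + 1) a (cohPt hπ (n + 1))) =
      inclPt (ltField_le_succ hπ n) (ltAct hπ n a (cohPt hπ n)) := by
  rw [ltAct_comm, ltAct_pi_cohPt_succ, inclPt_ltAct]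

/-- `f(x) = [π] x` as elements of `F̄`, for a point `x` of `𝔪_{K_π^{m+1}}` (`[π]_f = f`, a polynomial).
[cite: LubinTate1965, §1 Thm. 1 (11)] -/
theorem aeval_coe_ltPoly_eq_coe_ltAct_pi (m : ℕ) (x : (maxNilIdeal F (ltField π m)).toIdeal) :
    aeval (((x : unitBall (ltField π m)) : ltField π m) : AlgebraicClosure F) ((ltPoly F π).map (algebraMap 𝒪[F] F)) =
      ((((ltAct hπ m π x : (maxNilIdeal F (ltField π m)).toIdeal) : unitBall (ltField π m)) : ltField π m) :
        AlgebraicClosure F) := by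
  rw [ltAct, coe_ltSMul_pi hπ]
  change _ = algebraMap (ltField π m) (AlgebraicClosure F) (aeval _ _)
  rw [← Polynomial.aeval_algebraMap_apply]
  rfl

/-! ### Levelwise: every root of `φ_{n+1}` is `[u] ω_{n+1}` -/

include hπ in
/-- ★ **Every root of `φ_{n+1}` in `F̄` is `[u] ω_{n+1}` for a unit `u`** (tree `exists_unit_ltAct_genPt_eq` for `λ_{n+1}`,
and `ω_{n+1} = [u_n] λ_{n+1}`). [cite: CasselsFrohlichANT1967, Ch. VI §3.6 Prop. 6 (b)] [cite: deShalit1987, II §4.4] -/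
theorem exists_unit_coe_ltAct_cohPt_eq (n : ℕ) {μ : AlgebraicClosure F}
    (hμ : aeval μ ((ltPolyDiv F π n).map (algebraMap 𝒪[F] F)) = 0) :
    ∃ u : 𝒪[F]ˣ, ((((ltAct hπ n (u : 𝒪[F]) (cohPt hπ n) : (maxNilIdeal F (ltField π n)).toIdeal) :
      unitBall (ltField π n)) : ltField π n) : AlgebraicClosure F) = μ := by
  obtain ⟨u, hu⟩ := exists_unit_ltAct_genPt_eq hπ n hμ
  refine ⟨u * (cohUnit hπ n)⁻¹, ?_⟩
  rw [cohPt_eq, ← ltAct_mul, Units.val_mul, mul_assoc, ← Units.val_mul, inv_mul_cancel, Units.val_one, mul_one]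
  exact hu

/-! ### The limit: one unit for all levels -/

include hπ in
/-- ★★★ **Generators of the Tate module are unique up to one unit.**  Let `μ : ℕ → F̄` satisfy `φ_{n+1}(μ_n) = 0` (each `μ_n`
is a PRIMITIVE division point of level `n+1`) and `f(μ_{n+1}) = μ_n` (coherence) for all `n`.  Then there is `a ∈ 𝒪_Fˣ` with
**`[a] ω_{n+1} = μ_n` for every `n`** (`ω_{n+1} = cohPt hπ n` the tree's generator).  Proof: levelwise `μ_n = [u_n] ω_{n+1}`
(`exists_unit_coe_ltAct_cohPt_eq`); coherence of both sequences gives `[u_{n+1}] ω_{n+1} = [u_n] ω_{n+1}`, i.e.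
`u_{n+1} ≡ u_n (mod π^{n+1})`; the limit `a` exists in the `π`-adically complete `𝒪_F` (`exists_unit_forall_pow_dvd_sub`).
[cite: deShalit1987, Ch. I §2.2, II §4.4 (iii)–(iv)] [cite: CasselsFrohlichANT1967, Ch. VI §3.6 Prop. 6] -/
theorem exists_unit_forall_coe_ltAct_cohPt_eq {μ : ℕ → AlgebraicClosure F}
    (hdiv : ∀ n, aeval (μ n) ((ltPolyDiv F π n).map (algebraMap 𝒪[F] F)) = 0)
    (hcoh : ∀ n, aeval (μ (n + 1)) ((ltPoly F π).map (algebraMap 𝒪[F] F)) = μ n) :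
    ∃ a : 𝒪[F]ˣ, ∀ n, ((((ltAct hπ n (a : 𝒪[F]) (cohPt hπ n) : (maxNilIdeal F (ltField π n)).toIdeal) :
      unitBall (ltField π n)) : ltField π n) : AlgebraicClosure F) = μ n := by
  choose u hu using fun n => exists_unit_coe_ltAct_cohPt_eq hπ n (hdiv n)
  -- compatibility `u_{n+1} ≡ u_n (mod π^{n+1})`
  have hcompat : ∀ n, π ^ (n + 1) ∣ ((u (n + 1) : 𝒪[F]ˣ) : 𝒪[F]) - u n := by
    intro n
    rw [← ltAct_cohPt_eq_iff hπ]
    apply pt_ext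
    rw [hu n, ← hcoh n, ← hu (n + 1), aeval_coe_ltPoly_eq_coe_ltAct_pi, ltAct_pi_ltAct_cohPt_succ, coe_inclPt]
  obtain ⟨a, ha⟩ := exists_unit_forall_pow_dvd_sub hπ hcompat
  exact ⟨a, fun n => by rw [ltAct_cohPt_eq_of_dvd_sub hπ (ha n), hu n]⟩

include hπ in
/-- **… and the unit is unique**: `[a] ω_{n+1} = [b] ω_{n+1}` for all `n` forces `a ≡ b (mod π^{n+1})` for all `n`, so `a = b`
(`𝒪_F` is `π`-adically separated). [cite: deShalit1987, II §4.3 («uniquely determined modulo `𝒪_𝔭ˣ`»), §4.4]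
[cite: CasselsFrohlichANT1967, Ch. VI §3.6 Prop. 6] -/
theorem unit_eq_of_forall_coe_ltAct_cohPt_eq {a b : 𝒪[F]ˣ}
    (h : ∀ n, ((((ltAct hπ n (a : 𝒪[F]) (cohPt hπ n) : (maxNilIdeal F (ltField π n)).toIdeal) :
        unitBall (ltField π n)) : ltField π n) : AlgebraicClosure F) =
      ((((ltAct hπ n (b : 𝒪[F]) (cohPt hπ n) : (maxNilIdeal F (ltField π n)).toIdeal) :
        unitBall (ltField π n)) : ltField π n) : AlgebraicClosure F)) :
    a = b :=
  Units.ext (eq_of_forall_pow_dvd_sub hπ fun n => (ltAct_cohPt_eq_iff hπ).mp (pt_ext (h n)))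

include hπ in
/-- ★★★ **`∃! a ∈ 𝒪_Fˣ` with `[a] ω_{n+1} = μ_n` for all `n`** — de Shalit II §4.4: the generator `(ω_n)` (datum (iii)) is
determined by, and determines, one unit modulo which `Ω_p` is defined. [cite: deShalit1987, II §4.3, §4.4 (i)–(iv)]
[cite: CasselsFrohlichANT1967, Ch. VI §3.6 Prop. 6] -/
theorem existsUnique_unit_forall_coe_ltAct_cohPt_eq {μ : ℕ → AlgebraicClosure F}
    (hdiv : ∀ n, aeval (μ n) ((ltPolyDiv F π n).map (algebraMap 𝒪[F] F)) = 0)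
    (hcoh : ∀ n, aeval (μ (n + 1)) ((ltPoly F π).map (algebraMap 𝒪[F] F)) = μ n) :
    ∃! a : 𝒪[F]ˣ, ∀ n, ((((ltAct hπ n (a : 𝒪[F]) (cohPt hπ n) : (maxNilIdeal F (ltField π n)).toIdeal) :
      unitBall (ltField π n)) : ltField π n) : AlgebraicClosure F) = μ n := by
  obtain ⟨a, ha⟩ := exists_unit_forall_coe_ltAct_cohPt_eq hπ hdiv hcoh
  exact ⟨a, ha, fun b hb => unit_eq_of_forall_coe_ltAct_cohPt_eq hπ fun n => by rw [hb n, ha n]⟩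

/-- **Primitive AND coherent in the `[·]`-language** (the form the curve side produces): if points `y_n ∈ 𝔪_{E_n}` of finite
extensions `E_n ⊇ F` satisfy `[π^{n+1}] y_n = 0`, `[πⁿ] y_n ≠ 0`, then `μ_n := (y_n : F̄)` is a root of `φ_{n+1}`
(`coe_ltSMul_pow` + `aeval_ltPolyDiv_eq_zero_of_primitive`). [cite: CasselsFrohlichANT1967, Ch. VI §3.6 Prop. 6 (proof)] -/
theorem aeval_ltPolyDiv_coe_eq_zero_of_ltSMul_pow {E : IntermediateField F (AlgebraicClosure F)} [FiniteDimensional F E] {n : ℕ}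
    {y : (maxNilIdeal F E).toIdeal}
    (h1 : ltSMul (maxNilIdeal F E) (isLTRing_LTCoeff hπ) (isLTSeries_LTCoeff π) (LTCoeff.of F π ^ (n + 1)) y = 0)
    (h0 : ltSMul (maxNilIdeal F E) (isLTRing_LTCoeff hπ) (isLTSeries_LTCoeff π) (LTCoeff.of F π ^ n) y ≠ 0) :
    aeval (((y : unitBall E) : E) : AlgebraicClosure F) ((ltPolyDiv F π n).map (algebraMap 𝒪[F] F)) = 0 := by
  have h1' : aeval ((y : unitBall E) : E) ((ltPolyIter F π (n + 1)).map (algebraMap 𝒪[F] F)) = 0 := by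
    rw [← coe_ltSMul_pow hπ, h1]; rfl
  have h0' : aeval ((y : unitBall E) : E) ((ltPolyIter F π n).map (algebraMap 𝒪[F] F)) ≠ 0 := by
    rw [← coe_ltSMul_pow hπ]
    intro h
    exact h0 (Subtype.ext (Subtype.ext h))
  have h2 := aeval_ltPolyDiv_eq_zero_of_primitive (π := π) h1' h0'
  have h3 := congrArg (algebraMap E (AlgebraicClosure F)) h2
  rw [← Polynomial.aeval_algebraMap_apply, map_zero] at h3
  exact h3

/-- Coherence in the `[·]`-language: `[π] y' = ι(y)` in `𝔪_{E'}` (`E ≤ E'`) gives `f((y' : F̄)) = (y : F̄)`.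
[cite: deShalit1987, Ch. I §2.2] -/
theorem aeval_ltPoly_coe_eq_of_ltSMul_eq {E E' : IntermediateField F (AlgebraicClosure F)} [FiniteDimensional F E]
    [FiniteDimensional F E'] (hEE' : E ≤ E') {y : (maxNilIdeal F E).toIdeal} {y' : (maxNilIdeal F E').toIdeal}
    (h : ltSMul (maxNilIdeal F E') (isLTRing_LTCoeff hπ) (isLTSeries_LTCoeff π) (LTCoeff.of F π) y' = inclPt hEE' y) :
    aeval (((y' : unitBall E') : E') : AlgebraicClosure F) ((ltPoly F π).map (algebraMap 𝒪[F] F)) =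
      (((y : unitBall E) : E) : AlgebraicClosure F) := by
  have h2 := congrArg (fun z : (maxNilIdeal F E').toIdeal => (((z : unitBall E') : E') : AlgebraicClosure F)) h
  simp only [coe_inclPt] at h2
  rw [coe_ltSMul_pi hπ] at h2
  rw [← h2]
  change _ = algebraMap E' (AlgebraicClosure F) (aeval _ _)
  rw [← Polynomial.aeval_algebraMap_apply]
  rfl

end Concrete

end Literature.NumberTheory.GaloisRepresentations

end
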